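import Summits.ResolutionOfSingularities.ResolutionOfSingularities.Theorems.PurelyInseparableDim4SpivakovskyStrategy
import HarnessLib

/-!
# [OURS · res-dim4-pi PR-9c, part 3] Spivakovsky's game: moves preserve good positions and bounded
  denominators; the ONE-VERTEX regime (Lemma 3); two stabilisation lemmas

Cell `res-dim4-pi` (D-0157 DOOR 2), brick **PR-9c / NEED-FACT «Spivakovsky 1983»** (desk `boards/ROUTES.md`
WORD #25 (e): PR-9c consortium, lead `res-dim4-p-11`; this part = the split S1–S7 handed to seat `res-dim4-p-5`,
bus 2026-08-28T16:32:41Z). Def-free sequel of `…SpivakovskyDefs` / `…SpivakovskyStrategy` (p-11), stated with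
EXACTLY the signatures the lead imports. Source: M. Spivakovsky, *A solution to Hironaka's polyhedra game*,
Arithmetic and Geometry II (Progr. Math. 36, Birkhäuser 1983) 419–432 [cite: Spivakovsky1983, §III Lemma 3 and
p. 432 (denominators)].

* S1 `good_image_move` — a move `σ_{Γ,i}` along a permissible `Γ ⊆ I`, `i ∈ Γ`, keeps the position good on `I`;
* S2 `den_image_move`, S3 `exists_den`, S4 `exists_int_dG` / `exists_nat_dt` — «Let `N` be an upper bound on the
  denominators … Clearly `N` remains a bound after the transformation `σ_{Γ,i}`» (p. 432): bounded denominators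
  persist, exist, and make `d_Γ(G)·N ∈ ℤ`, `d(G̃)·N ∈ ℕ`;
* S5 **Lemma 3 (the one-vertex regime `d(G̃) = 0`, i.e. `ω ∈ G`)**: after the strategy's move the position is
  again one-vertex (`dt_image_move_eq_zero`) and `d(G)` drops STRICTLY (`dG_image_move_lt`: by
  `Σ_{Γ∖i} ω < 1`, minimality of `Γ = minPerm`);
* S6 `exists_stable_of_antitone`, S7 `exists_stable_of_chain` — an antitone `ℕ`-sequence, resp. an increasing
  chain of subsets of `I`, is eventually constant (the two stabilisations of the termination argument, p. 431–432).

[OURS · counted 0 · AI work weaker than expert review] Kernel transcription of a 1983 combinatorial theorem used by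
OUR frame's spine game; NOTHING here is a theorem about resolution of singularities in dimension ≥ 4 /
characteristic `p`. bears_on: LADDER-RESOLUTION:D157-DOOR2 (res-dim4-pi · PR-9c). Supports
stmt-ResolutionOfSingularities-16155 (helper).
-/

set_option linter.dupNamespace false -- mandated namespace of this single-conjunct summit

open Finset
open scoped BigOperators

namespace Summit.ResolutionOfSingularities.ResolutionOfSingularities.Theorems.PIDim4

namespace Spivakovsky

variable {σ : Type} [Fintype σ] [DecidableEq σ]

section OneVertex

variable {I Γ : Finset σ} {G : Pos σ} {i : σ} {N : ℕ}

/-! ## S1 Moves keep good positions good -/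

/-- Membership in the moved position. [folklore] -/
theorem mem_image_move_iff {y : σ → ℚ} : y ∈ G.image (move Γ i) ↔ ∃ g ∈ G, move Γ i g = y :=
  Finset.mem_image

/-- **S1.** A move `σ_{Γ,i}` along a permissible `Γ ⊆ I` with `i ∈ Γ` keeps the position good on `I`
(non-empty, non-negative — the new `i`-th coordinate is `Σ_Γ g − 1 ≥ 0` by permissibility —, zero off `I`).
[cite: Spivakovsky1983, §I (the transformation σ_{Γ,i})] -/
theorem good_image_move (hgood : Good I G) (hΓ : Γ ⊆ I) (hP : Perm Γ G) (hi : i ∈ Γ) :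
    Good I (G.image (move Γ i)) := by
  refine ⟨hgood.1.image _, fun y hy k => ?_, fun y hy k hk => ?_⟩
  · obtain ⟨g, hg, rfl⟩ := mem_image_move_iff.mp hy
    by_cases hki : k = i
    · subst hki
      rw [move_apply_self]
      linarith [hP.2 g hg]
    · rw [move_apply_of_ne Γ hki]
      exact hgood.2.1 g hg k
  · obtain ⟨g, hg, rfl⟩ := mem_image_move_iff.mp hy
    have hki : k ≠ i := fun h => hk (h ▸ hΓ hi)
    rw [move_apply_of_ne Γ hki]
    exact hgood.2.2 g hg k hk

/-! ## S2–S4 Bounded denominators -/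

/-- **S2.** Bounded denominators persist under every move («Clearly `N` remains a bound after the
transformation `σ_{Γ,i}`»). [cite: Spivakovsky1983, §III p. 432] -/
theorem den_image_move (hD : Den N G) (Γ : Finset σ) (i : σ) : Den N (G.image (move Γ i)) := by
  intro y hy k
  obtain ⟨g, hg, rfl⟩ := mem_image_move_iff.mp hy
  by_cases hki : k = i
  · subst hki
    choose z hz using hD g hg
    refine ⟨∑ j ∈ Γ, z j - N, ?_⟩
    rw [move_apply_self, sub_mul, Finset.sum_mul, one_mul]
    push_cast
    rw [Finset.sum_congr rfl fun j _ => hz j]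
  · rw [move_apply_of_ne Γ hki]
    exact hD g hg k

/-- **S3.** Every position has bounded denominators (`N` = the product of all denominators).
[cite: Spivakovsky1983, §III p. 432] -/
theorem exists_den (G : Pos σ) : ∃ N : ℕ, 0 < N ∧ Den N G := by
  classical
  refine ⟨∏ g ∈ G, ∏ k, (g k).den, ?_, fun g hg k => ?_⟩
  · exact Finset.prod_pos fun g _ => Finset.prod_pos fun k _ => (g k).den_pos
  · have hdvd : (g k).den ∣ ∏ g ∈ G, ∏ k, (g k).den :=
      dvd_trans (Finset.dvd_prod_of_mem (fun k => (g k).den) (Finset.mem_univ k))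
        (Finset.dvd_prod_of_mem (fun g => ∏ k, (g k).den) hg)
    obtain ⟨c, hc⟩ := hdvd
    refine ⟨(g k).num * c, ?_⟩
    rw [hc]
    push_cast
    rw [← mul_assoc, Rat.mul_den_eq_num]

/-- A sum of coordinates of a generator with denominators bounded by `N` is in `(1/N)ℤ`. [folklore] -/
theorem exists_int_sum (hD : Den N G) {g : σ → ℚ} (hg : g ∈ G) (Γ : Finset σ) :
    ∃ z : ℤ, (∑ j ∈ Γ, g j) * N = z := by
  choose z hz using hD g hg
  refine ⟨∑ j ∈ Γ, z j, ?_⟩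
  rw [Finset.sum_mul]
  push_cast
  exact Finset.sum_congr rfl fun j _ => hz j

/-- **S4 (a).** `d_Γ(G)·N ∈ ℤ` (the minimum is attained on a generator). [cite: Spivakovsky1983, §III p. 432] -/
theorem exists_int_dG (hD : Den N G) (hG : G.Nonempty) (Γ : Finset σ) : ∃ z : ℤ, dG Γ G * N = z := by
  obtain ⟨g, hg, hgd⟩ := exists_dG_eq Γ hG
  rw [← hgd]
  exact exists_int_sum hD hg Γ

/-- `ω_k·N ∈ ℤ` (the coordinatewise minimum is attained). [folklore] -/
theorem exists_int_omega (hD : Den N G) (hG : G.Nonempty) (k : σ) : ∃ z : ℤ, omega G k * N = z := by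
  obtain ⟨g, hg, hgk⟩ := exists_omega_eq hG k
  rw [← hgk]
  exact hD g hg k

/-- **S4 (b).** `d(G̃)·N ∈ ℕ` on a good position (it is `≥ 0` and in `(1/N)ℤ`).
[cite: Spivakovsky1983, §III p. 432] -/
theorem exists_nat_dt (hgood : Good I G) (hD : Den N G) : ∃ m : ℕ, dt I G * N = m := by
  have hG := hgood.1
  obtain ⟨z, hz⟩ := exists_int_dG hD hG I
  choose w hw using fun k => exists_int_omega hD hG k
  have hint : dt I G * N = ((z - ∑ k ∈ I, w k : ℤ) : ℚ) := by
    rw [dt_eq I hG, sub_mul, hz, Finset.sum_mul]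
    push_cast
    rw [Finset.sum_congr rfl fun k _ => hw k]
  have hnn : (0 : ℚ) ≤ ((z - ∑ k ∈ I, w k : ℤ) : ℚ) := by
    rw [← hint]
    exact mul_nonneg (dt_nonneg I hG) (Nat.cast_nonneg N)
  refine ⟨(z - ∑ k ∈ I, w k).toNat, ?_⟩
  rw [hint]
  have h0 : (0 : ℤ) ≤ z - ∑ k ∈ I, w k := by exact_mod_cast hnn
  rw [← Int.toNat_of_nonneg h0]
  push_cast
  rw [Int.toNat_of_nonneg h0]

/-! ## S5 Lemma 3: the one-vertex regime -/

/-- In the one-vertex regime (`d(G̃) = 0`, i.e. `ω ∈ G`), `d_I(G) = |ω|_I`. [cite: Spivakovsky1983, §III Lemma 3] -/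
theorem dG_eq_sum_omega_of_dt_eq_zero (hG : G.Nonempty) (hdt : dt I G = 0) :
    dG I G = ∑ k ∈ I, omega G k := by
  have := dt_eq I hG
  rw [hdt] at this
  linarith

/-- With `d(G) ≥ 1` a permissible subset of `I` exists (namely `I`). [folklore] -/
theorem exists_perm_of_one_le_dG (hG : G.Nonempty) (hd : 1 ≤ dG I G) : ∃ Γ ⊆ I, Perm Γ G :=
  ⟨I, le_rfl, perm_self_of_one_le_dG hG hd⟩

/-- The move is monotone above `ω`: `σ_{Γ,i}(ω) ≤ σ_{Γ,i}(g)` coordinatewise for `g ∈ G`. [folklore] -/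
theorem move_omega_le {g : σ → ℚ} (hg : g ∈ G) (Γ : Finset σ) (i k : σ) :
    move Γ i (omega G) k ≤ move Γ i g k := by
  by_cases hki : k = i
  · subst hki
    rw [move_apply_self, move_apply_self]
    exact sub_le_sub_right (Finset.sum_le_sum fun j _ => omega_le hg j) _
  · rw [move_apply_of_ne Γ hki, move_apply_of_ne Γ hki]
    exact omega_le hg k

/-- If `ω ∈ G`, then `ω(G′) = σ_{Γ,i}(ω)` for `G′ = σ_{Γ,i}(G)`. [cite: Spivakovsky1983, §III Lemma 3] -/
theorem omega_image_move_eq (hω : omega G ∈ G) (Γ : Finset σ) (i : σ) :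
    omega (G.image (move Γ i)) = move Γ i (omega G) := by
  have hG : G.Nonempty := ⟨_, hω⟩
  have hG' : (G.image (move Γ i)).Nonempty := hG.image _
  funext k
  apply le_antisymm
  · exact omega_le (Finset.mem_image_of_mem _ hω) k
  · refine le_omega hG' k fun y hy => ?_
    obtain ⟨g, hg, rfl⟩ := mem_image_move_iff.mp hy
    exact move_omega_le hg Γ i k

/-- **S5 (a), Lemma 3.** In the one-vertex regime the strategy's move leads again to a one-vertex position:
`d(G̃′) = 0`. [cite: Spivakovsky1983, §III Lemma 3] -/
theorem dt_image_move_eq_zero (hgood : Good I G) (hd : 1 ≤ dG I G) (hdt : dt I G = 0)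
    (hi : i ∈ strat I G) : dt I (G.image (move (strat I G) i)) = 0 := by
  have hG := hgood.1
  have hω : omega G ∈ G := (dt_eq_zero_iff hgood).mp hdt
  have hex := exists_perm_of_one_le_dG hG hd
  have hstrat : strat I G = minPerm I G := strat_eq_minPerm hdt
  have hspec := minPerm_spec hex
  have hΓI : strat I G ⊆ I := hstrat ▸ hspec.1
  have hPerm : Perm (strat I G) G := hstrat ▸ hspec.2.1
  have hgood' : Good I (G.image (move (strat I G) i)) := good_image_move hgood hΓI hPerm hi
  rw [dt_eq_zero_iff hgood', omega_image_move_eq hω]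
  exact Finset.mem_image_of_mem _ hω

/-- In a minimal permissible `Γ` the coordinates of `ω` off the chart sum to `< 1`: `Σ_{Γ∖i} ω < 1`
(`Γ ∖ i` is not permissible). [cite: Spivakovsky1983, §III Lemma 3] -/
theorem sum_erase_omega_lt_one (hgood : Good I G) (hd : 1 ≤ dG I G) (hi : i ∈ minPerm I G) :
    ∑ j ∈ (minPerm I G).erase i, omega G j < 1 := by
  have hG := hgood.1
  have hex := exists_perm_of_one_le_dG hG hd
  have hss : (minPerm I G).erase i ⊂ minPerm I G := Finset.erase_ssubset hi
  have hnp := not_perm_of_ssubset_minPerm hex hss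
  unfold Perm at hnp
  rw [not_and_or] at hnp
  rcases hnp with hne | hlt
  · rw [Finset.not_nonempty_iff_eq_empty] at hne
    rw [hne, Finset.sum_empty]
    exact zero_lt_one
  · push Not at hlt
    obtain ⟨g, hg, hg1⟩ := hlt
    exact lt_of_le_of_lt (Finset.sum_le_sum fun j _ => omega_le hg j) hg1

omit [Fintype σ] in
/-- `|σ_{Γ,i}(ω)|_I = |ω|_I + Σ_{Γ∖i} ω − 1` for `i ∈ Γ ⊆ I`. [cite: Spivakovsky1983, §III Lemma 3] -/
theorem sum_move_omega_eq (hΓ : Γ ⊆ I) (hi : i ∈ Γ) (x : σ → ℚ) :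
    ∑ k ∈ I, move Γ i x k = ∑ k ∈ I, x k + ∑ j ∈ Γ.erase i, x j - 1 := by
  have hiI : i ∈ I := hΓ hi
  rw [← Finset.add_sum_erase I _ hiI, ← Finset.add_sum_erase I (fun k => x k) hiI, move_apply_self,
    ← Finset.add_sum_erase Γ (fun k => x k) hi]
  have : ∑ k ∈ I.erase i, move Γ i x k = ∑ k ∈ I.erase i, x k :=
    Finset.sum_congr rfl fun k hk => move_apply_of_ne Γ (Finset.ne_of_mem_erase hk) x
  rw [this]
  ring

/-- **S5 (b), Lemma 3.** In the one-vertex regime the strategy's move makes `d(G)` drop STRICTLY: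
`d(G′) = d(G) + Σ_{Γ∖i} ω − 1 < d(G)`. [cite: Spivakovsky1983, §III Lemma 3] -/
theorem dG_image_move_lt (hgood : Good I G) (hd : 1 ≤ dG I G) (hdt : dt I G = 0)
    (hi : i ∈ strat I G) : dG I (G.image (move (strat I G) i)) < dG I G := by
  have hG := hgood.1
  have hω : omega G ∈ G := (dt_eq_zero_iff hgood).mp hdt
  have hex := exists_perm_of_one_le_dG hG hd
  have hstrat : strat I G = minPerm I G := strat_eq_minPerm hdt
  have hspec := minPerm_spec hex
  have hΓI : strat I G ⊆ I := hstrat ▸ hspec.1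
  have hi' : i ∈ minPerm I G := hstrat ▸ hi
  have hdt' := dt_image_move_eq_zero hgood hd hdt hi
  rw [dG_eq_sum_omega_of_dt_eq_zero (hG.image _) hdt', dG_eq_sum_omega_of_dt_eq_zero hG hdt,
    omega_image_move_eq hω, sum_move_omega_eq hΓI hi]
  have hlt := sum_erase_omega_lt_one hgood hd hi'
  rw [← hstrat] at hlt
  linarith

/-! ## S6–S7 Stabilisation -/

omit [Fintype σ] [DecidableEq σ] in
/-- **S6.** An antitone sequence of natural numbers is eventually constant. [folklore] -/
theorem exists_stable_of_antitone {f : ℕ → ℕ} (h : ∀ l, f (l + 1) ≤ f l) :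
    ∃ l₀, ∀ l, l₀ ≤ l → f l = f l₀ := by
  have hanti : Antitone f := antitone_nat_of_succ_le h
  have hne : (Set.range f).Nonempty := ⟨f 0, 0, rfl⟩
  obtain ⟨l₀, hl₀⟩ : ∃ l₀, f l₀ = sInf (Set.range f) := Nat.sInf_mem hne
  refine ⟨l₀, fun l hl => le_antisymm (hanti hl) ?_⟩
  rw [hl₀]
  exact Nat.sInf_le ⟨l, rfl⟩

omit [Fintype σ] [DecidableEq σ] in
/-- **S7.** An increasing chain of subsets of a finite set `I` is eventually constant. [folklore] -/
theorem exists_stable_of_chain {T : ℕ → Finset σ} (hmono : ∀ l, T l ⊆ T (l + 1)) (hbd : ∀ l, T l ⊆ I) :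
    ∃ l₀, ∀ l, l₀ ≤ l → T l = T l₀ := by
  have hmono' : Monotone T := monotone_nat_of_le_succ hmono
  have hanti : ∀ l, I.card - (T (l + 1)).card ≤ I.card - (T l).card := fun l => by
    have h1 := Finset.card_le_card (hmono l)
    have h2 := Finset.card_le_card (hbd (l + 1))
    omega
  obtain ⟨l₀, hl₀⟩ := exists_stable_of_antitone (f := fun l => I.card - (T l).card) hanti
  refine ⟨l₀, fun l hl => ?_⟩
  have hsub : T l₀ ⊆ T l := hmono' hl
  have hc : I.card - (T l).card = I.card - (T l₀).card := hl₀ l hl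
  have h1 := Finset.card_le_card (hbd l)
  have h2 := Finset.card_le_card (hbd l₀)
  exact (Finset.eq_of_subset_of_card_le hsub (by omega)).symm

end OneVertex

end Spivakovsky

end Summit.ResolutionOfSingularities.ResolutionOfSingularities.Theorems.PIDim4
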